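import Literature.Probability.RandomPlanarGeometry.SAWCountZdSymbolLetterConditions
import Literature.Probability.RandomPlanarGeometry.SAWCountZdSymbolSecondTopCount
import Literature.Probability.RandomPlanarGeometry.SAWCountZdSymbolThirdCoefficient
import HarnessLib

/-!
# THE THIRD-LAYER MIDDLE CENSUS: `3·X'_j + (2j−5)(9(2j−7)‼ + 3(2j−6)K_j)·2^{2j−4} = (2j−5)(2j−4)(j+3)(2j−5)‼·2^{2j−3}` for every `j ≥ 3`

Topic `Literature/Probability/RandomPlanarGeometry` (the «SYMBOL POLYNOMIALITY» programme, third layer; on `SAWCountZdSymbolLetterConditions.lean` (a-p1 g27: prescribed letters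
in a one-block class = «position in a block» × `2^{m−3}`, the (A, B, ρ) transports, marked blocks of `twoParts`, the five-run decomposition `card_shapeClass_fiveVec_add` for
every `m`), `SAWCountZdSymbolSecondLowerCount.lean` (a-p1 g26: `abData`, `three_mul_card_shapeClass_secondLower` — the one-block count on `2j − 1` letters),
`SAWCountZdSymbolSecondTopCount.lean` (a-p1 g26: the classification `exists_eq_fiveVec_or_splitVec` (every `m`), `splitIdx`), `SAWCountZdSymbolSplitRun.lean`
(`shapeClass_splitVec_eq_filter`, every `m`), `SAWCountZdSymbolThirdCoefficient.lean` (a-p1 g26: `thirdShapeSumMid`)).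

PRINTED CONTEXT (locators only; nothing is quoted digit-for-digit). Madras–Slade (1993) §1.1 eq. (1.1.8) p. 5, Definition 1.2.4, §1.2 p. 10; Clisby–Liang–Slade (2007)
§3.3 eqs. (29)/(31); Glimm–Jaffe (1987) (3.2.13); Stanley EC1 §1.3. NOT IN PRINT as far as the lane's desks could locate: the statements below.

THE THEOREM. The third-layer MIDDLE corner `X'_j = thirdShapeSumMid j` of `SAWCountZdSymbolThirdCoefficient.coeff_symbolPoly_two_mul_sub_five` sums the classes on
`m = 2j − 1` letters (one axis THRICE, the others twice) with four adjacencies: the `2j − 5` five-run vectors and the `(2j−5)(2j−6)` split vectors (6c's classification, every `m`).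
In (A, B, ρ) coordinates on the `2j − 5 = 2k + 1` outside positions (`k = j − 3`): ★ `card_abData_filter_fst/snd` — an outer position tied to a block axis: `(2k−1)‼`
(`sum_disjPairs_eq`: only `#A + #B ≤ 1` survives); ★★ `card_abData_filter_sameBlock` — two outer positions in one block: **`K_j = C(2k−1,3)(2k−5)‼ + 3(2k−1)(2k−3)‼`** (the pair
block, the triple, or a pair next to a singleton `A`/`B`). Hence on `T_p = shapeClass j (2j−1) (topVec (2j−1) p)`: ★★ `card_filter_letter_base_mid` / `…_succ_mid` — a
prescribed outer letter equal (or reversed) to the letter at `p` or `p+1`: `(2j−7)‼·2^{2j−4}`; ★★ `card_filter_rev_outer_mid` — a reversal pair at outer `(q, q')`: `K_j·2^{2j−4}`.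
So ★★ `three_mul_card_shapeClass_fiveVec_mid`: **`3·#five(s) + 9(2j−7)‼2^{2j−4} = 2(j+3)(2j−5)‼2^{2j−3}`** (two one-block classes minus the three exceptional words `x y x̄ ȳ y`,
`x̄ x y x̄ ȳ`, `x y x̄ ȳ x` — each a tripled block axis), ★★ `three_mul_card_shapeClass_splitVec_mid`: **`3·#split(i,q) + 3K_j·2^{2j−4} = (j+3)(2j−5)‼2^{2j−3}`**, and ★★★
`three_mul_thirdShapeSumMid_add`: **`3·X'_j + (2j−5)·(9(2j−7)‼ + 3(2j−6)K_j)·2^{2j−4} = (2j−5)(2j−4)(j+3)(2j−5)‼·2^{2j−3}` for every `j ≥ 3`** — the lane's censuses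
`X'_3 … X'_6 = 20, 2256, 137920, 8359680`, `X'_7 = 546 739 200` (kit j306081) and the BLIND-predicted `X'_8 = M_8(15,11) = 39 242 649 600` (register «Am. BR» cell BR-3, kit j306083 HIT)
are its instances (`thirdShapeSumMid_values`). The second of the three census identities that make the THIRD CANCELLATION unconditional.
Tool notion (the lane's): `thirdMidK`.

THIS FILE (lane «pcv-sawmu», a-p1 g27; all PROVED, standard axioms): `filter_sigma_eq` (private), `sum_disjPairs_eq`, ★ `card_abData_filter_fst`, ★ `card_abData_filter_snd`,
`thirdMidK`, ★★ `card_abData_filter_sameBlock`, `outer_facts_mid` (private), ★★ `card_filter_letter_base_mid`, ★★ `card_filter_letter_base_rev_mid`, ★★ `card_filter_letter_succ_mid`,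
★★ `card_filter_rev_outer_mid`, ★★ `three_mul_card_shapeClass_fiveVec_mid`, ★★ `three_mul_card_shapeClass_splitVec_mid`, ★★★ `three_mul_thirdShapeSumMid_add`,
`thirdShapeSumMid_values`.
[cite: MadrasSlade1993, §1.1 eq. (1.1.8) p. 5; Definition 1.2.4; §1.2 (p. 10)] [cite: ClisbyLiangSlade2007, §3.3 eqs. (29)/(31)] [cite: GlimmJaffeQP1987, (3.2.13) §3.2]
[cite: Stanley2012EC1, §1.3]

Provenance: lane «pcv-sawmu», a-p1 g27 (2026-08-28).
-/

open Finset
open scoped BigOperators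
open Literature.Probability.LatticeModels
open Literature.Probability.RandomPlanarGeometry.SAW
open Literature.Probability.Percolation
open Literature.MathematicalPhysics.QuantumFieldTheory.Balaban1983to89
open Literature.MathematicalPhysics.QuantumFieldTheory.Balaban1983to89.HiggsFluctMeasureWickPairings

namespace Literature.Probability.RandomPlanarGeometry.SAW.Zd

namespace WordTypes

variable {m : ℕ}

/-! ### Sums over the disjoint pairs `(A, B)`: only `#A + #B ≤ 1` survives -/

/-- Filtering a sigma-set by a predicate filters each fibre. [cite: Stanley2012EC1, §1.3; lane plumbing] -/
private theorem filter_sigma_eq {ι : Type*} {β : Type*} [DecidableEq ι] (S : Finset ι) (f : ι → Finset β) (P : (Σ _ : ι, β) → Prop) [DecidablePred P] :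
    (S.sigma f).filter P = S.sigma fun x => (f x).filter fun y => P ⟨x, y⟩ := by
  ext ⟨x, y⟩
  simp only [Finset.mem_filter, Finset.mem_sigma]
  tauto

open Classical in
/-- A sum over the disjoint pairs `(A, B)` inside `O` of a function vanishing when `#A + #B ≥ 2` is its value at `(∅, ∅)` plus the singleton values.
[cite: MadrasSlade1993, Definition 1.2.4; lane lemma] -/
theorem sum_disjPairs_eq (O : Finset (Fin m)) (h : Finset (Fin m) × Finset (Fin m) → ℕ)
    (h0 : ∀ AB ∈ (O.powerset ×ˢ O.powerset).filter (fun AB => Disjoint AB.1 AB.2), 2 ≤ AB.1.card + AB.2.card → h AB = 0) :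
    ∑ AB ∈ (O.powerset ×ˢ O.powerset).filter (fun AB => Disjoint AB.1 AB.2), h AB = h (∅, ∅) + ∑ o ∈ O, (h ({o}, ∅) + h (∅, {o})) := by
  set D := (O.powerset ×ˢ O.powerset).filter (fun AB : Finset (Fin m) × Finset (Fin m) => Disjoint AB.1 AB.2) with hD
  have hsplit : ∑ AB ∈ D, h AB = ∑ AB ∈ D.filter (fun AB => AB.1.card + AB.2.card = 0), h AB +
      (∑ AB ∈ D.filter (fun AB => AB.1.card + AB.2.card = 1), h AB + ∑ AB ∈ D.filter (fun AB => 2 ≤ AB.1.card + AB.2.card), h AB) := by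
    rw [← Finset.sum_filter_add_sum_filter_not D (fun AB => AB.1.card + AB.2.card = 0)]
    congr 1
    rw [← Finset.sum_filter_add_sum_filter_not (D.filter fun AB => ¬ AB.1.card + AB.2.card = 0) (fun AB => AB.1.card + AB.2.card = 1)]
    congr 1
    · refine Finset.sum_congr ?_ (fun _ _ => rfl)
      ext AB; simp only [Finset.mem_filter]
      constructor
      · rintro ⟨⟨h1, -⟩, h3⟩; exact ⟨h1, h3⟩
      · rintro ⟨h1, h3⟩; exact ⟨⟨h1, by omega⟩, h3⟩
    · refine Finset.sum_congr ?_ (fun _ _ => rfl)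
      ext AB; simp only [Finset.mem_filter]
      constructor
      · rintro ⟨⟨h1, h2⟩, h3⟩; exact ⟨h1, by omega⟩
      · rintro ⟨h1, h3⟩; exact ⟨⟨h1, by omega⟩, by omega⟩
  have hD0 : D.filter (fun AB => AB.1.card + AB.2.card = 0) = {(∅, ∅)} := by
    ext AB
    rw [Finset.mem_filter, Finset.mem_singleton, hD, Finset.mem_filter, Finset.mem_product, Finset.mem_powerset, Finset.mem_powerset]
    constructor
    · rintro ⟨-, h⟩
      exact Prod.ext (Finset.card_eq_zero.1 (by omega)) (Finset.card_eq_zero.1 (by omega))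
    · rintro rfl; simp
  have hD1 : D.filter (fun AB => AB.1.card + AB.2.card = 1) =
      O.image (fun o => (({o} : Finset (Fin m)), (∅ : Finset (Fin m)))) ∪ O.image (fun o => (∅, {o})) := by
    ext AB
    rw [Finset.mem_filter, Finset.mem_union, Finset.mem_image, Finset.mem_image, hD, Finset.mem_filter, Finset.mem_product, Finset.mem_powerset,
      Finset.mem_powerset]
    constructor
    · rintro ⟨⟨⟨hA, hB⟩, -⟩, hs⟩
      rcases Nat.eq_zero_or_pos AB.1.card with h1 | h1
      · obtain ⟨o, ho⟩ := Finset.card_eq_one.1 (show AB.2.card = 1 by omega)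
        refine Or.inr ⟨o, hB (by rw [ho]; simp), ?_⟩
        rw [← ho, ← Finset.card_eq_zero.1 h1]
      · obtain ⟨o, ho⟩ := Finset.card_eq_one.1 (show AB.1.card = 1 by omega)
        refine Or.inl ⟨o, hA (by rw [ho]; simp), ?_⟩
        rw [← ho, ← Finset.card_eq_zero.1 (show AB.2.card = 0 by omega)]
    · rintro (⟨o, ho, rfl⟩ | ⟨o, ho, rfl⟩)
      · exact ⟨⟨⟨by simpa using ho, Finset.empty_subset _⟩, by simp⟩, by simp⟩
      · exact ⟨⟨⟨Finset.empty_subset _, by simpa using ho⟩, by simp⟩, by simp⟩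
  have hdisj1 : Disjoint (O.image (fun o => (({o} : Finset (Fin m)), (∅ : Finset (Fin m))))) (O.image (fun o => (∅, {o}))) := by
    rw [Finset.disjoint_left]
    rintro AB h1 h2
    obtain ⟨o, -, rfl⟩ := Finset.mem_image.1 h1
    obtain ⟨o', -, h⟩ := Finset.mem_image.1 h2
    have := congrArg Prod.fst h
    simp at this
  have hsum2 : ∑ AB ∈ D.filter (fun AB => 2 ≤ AB.1.card + AB.2.card), h AB = 0 :=
    Finset.sum_eq_zero fun AB hAB => h0 AB (Finset.mem_filter.1 hAB).1 (Finset.mem_filter.1 hAB).2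
  rw [hsplit, hD0, Finset.sum_singleton, hD1, Finset.sum_union hdisj1, Finset.sum_image (fun a _ b _ h => by simpa using congrArg Prod.fst h),
    Finset.sum_image (fun a _ b _ h => by simpa using congrArg Prod.snd h), hsum2, add_zero, Finset.sum_add_distrib]

/-! ### ★ The (A, B, ρ) counts on `2k + 1` outside positions -/

section AB

variable {j p : ℕ}

open Classical in
/-- ★ An outer position in `A`: `#{d ∈ abData (2j−1) j p | q' ∈ A} = (2j−7)‼` (`A = {q'}`, `B = ∅`, a perfect matching of the other `2j − 6` outside positions).
[cite: MadrasSlade1993, Definition 1.2.4; lane lemma] -/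
theorem card_abData_filter_fst (hj : 3 ≤ j) (hp : p + 4 ≤ 2 * j - 1) {q' : Fin (2 * j - 1)} (hq' : q' ∈ outerPos (2 * j - 1) p hp) :
    ((abData (2 * j - 1) j p hp).filter fun d => q' ∈ d.1.1).card = (2 * j - 7).doubleFactorial := by
  obtain ⟨k, rfl⟩ : ∃ k, j = k + 3 := ⟨j - 3, by omega⟩
  have hO : (outerPos (2 * (k + 3) - 1) p hp).card = 2 * k + 1 := by rw [card_outerPos hp]; omega
  rw [show 2 * (k + 3) - 7 = 2 * k - 1 by omega]
  unfold abData
  rw [filter_sigma_eq, Finset.card_sigma, show 2 * (k + 3) - 1 - (k + 3) - 2 = k by omega]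
  generalize hOdef : outerPos (2 * (k + 3) - 1) p hp = O at hO hq'
  refine (sum_disjPairs_eq O (fun AB => ((twoParts (O \ (AB.1 ∪ AB.2)) k).filter fun _ => q' ∈ AB.1).card) (fun AB hAB hs => ?_)).trans ?_
  · rw [Finset.mem_filter, Finset.mem_product, Finset.mem_powerset, Finset.mem_powerset] at hAB
    obtain ⟨⟨hA, hB⟩, hd⟩ := hAB
    have hle := Finset.card_le_card (Finset.union_subset hA hB)
    rw [Finset.card_union_of_disjoint hd, hO] at hle
    rw [twoParts_eq_empty_of_lt (by
      rw [Finset.card_sdiff_of_subset (Finset.union_subset hA hB), Finset.card_union_of_disjoint hd, hO]; omega), Finset.filter_empty,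
      Finset.card_empty]
  · have h00 : ((twoParts (O \ ((∅ : Finset _) ∪ ∅)) k).filter fun _ => q' ∈ (∅ : Finset (Fin (2 * (k + 3) - 1)))).card = 0 := by
      rw [Finset.filter_false_of_mem (fun _ _ => Finset.notMem_empty _), Finset.card_empty]
    have h1 : ∀ o ∈ O, ((twoParts (O \ ({o} ∪ ∅)) k).filter fun _ => q' ∈ ({o} : Finset (Fin (2 * (k + 3) - 1)))).card +
        ((twoParts (O \ (∅ ∪ {o})) k).filter fun _ => q' ∈ (∅ : Finset (Fin (2 * (k + 3) - 1)))).card = if o = q' then (2 * k - 1).doubleFactorial else 0 := by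
      intro o ho
      rw [Finset.filter_false_of_mem (s := twoParts (O \ (∅ ∪ {o})) k) (fun _ _ => Finset.notMem_empty _), Finset.card_empty, add_zero, Finset.union_empty]
      split_ifs with hoq
      · subst hoq
        rw [Finset.filter_true_of_mem (fun _ _ => Finset.mem_singleton_self _),
          card_twoParts_of_card_eq (k := k) (by rw [Finset.card_sdiff_of_subset (Finset.singleton_subset_iff.2 ho), hO, Finset.card_singleton]; omega)]
      · rw [Finset.filter_false_of_mem (fun _ _ h => hoq (Finset.mem_singleton.1 h).symm), Finset.card_empty]
    rw [h00, zero_add, Finset.sum_congr rfl h1, Finset.sum_ite_eq' O q', if_pos hq']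

open Classical in
/-- ★ An outer position in `B`: `#{d ∈ abData (2j−1) j p | q' ∈ B} = (2j−7)‼`. [cite: MadrasSlade1993, Definition 1.2.4; lane lemma] -/
theorem card_abData_filter_snd (hj : 3 ≤ j) (hp : p + 4 ≤ 2 * j - 1) {q' : Fin (2 * j - 1)} (hq' : q' ∈ outerPos (2 * j - 1) p hp) :
    ((abData (2 * j - 1) j p hp).filter fun d => q' ∈ d.1.2).card = (2 * j - 7).doubleFactorial := by
  obtain ⟨k, rfl⟩ : ∃ k, j = k + 3 := ⟨j - 3, by omega⟩
  have hO : (outerPos (2 * (k + 3) - 1) p hp).card = 2 * k + 1 := by rw [card_outerPos hp]; omega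
  rw [show 2 * (k + 3) - 7 = 2 * k - 1 by omega]
  unfold abData
  rw [filter_sigma_eq, Finset.card_sigma, show 2 * (k + 3) - 1 - (k + 3) - 2 = k by omega]
  generalize hOdef : outerPos (2 * (k + 3) - 1) p hp = O at hO hq'
  refine (sum_disjPairs_eq O (fun AB => ((twoParts (O \ (AB.1 ∪ AB.2)) k).filter fun _ => q' ∈ AB.2).card) (fun AB hAB hs => ?_)).trans ?_
  · rw [Finset.mem_filter, Finset.mem_product, Finset.mem_powerset, Finset.mem_powerset] at hAB
    obtain ⟨⟨hA, hB⟩, hd⟩ := hAB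
    have hle := Finset.card_le_card (Finset.union_subset hA hB)
    rw [Finset.card_union_of_disjoint hd, hO] at hle
    rw [twoParts_eq_empty_of_lt (by
      rw [Finset.card_sdiff_of_subset (Finset.union_subset hA hB), Finset.card_union_of_disjoint hd, hO]; omega), Finset.filter_empty,
      Finset.card_empty]
  · have h00 : ((twoParts (O \ ((∅ : Finset _) ∪ ∅)) k).filter fun _ => q' ∈ (∅ : Finset (Fin (2 * (k + 3) - 1)))).card = 0 := by
      rw [Finset.filter_false_of_mem (fun _ _ => Finset.notMem_empty _), Finset.card_empty]
    have h1 : ∀ o ∈ O, ((twoParts (O \ ({o} ∪ ∅)) k).filter fun _ => q' ∈ (∅ : Finset (Fin (2 * (k + 3) - 1)))).card +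
        ((twoParts (O \ (∅ ∪ {o})) k).filter fun _ => q' ∈ ({o} : Finset (Fin (2 * (k + 3) - 1)))).card = if o = q' then (2 * k - 1).doubleFactorial else 0 := by
      intro o ho
      rw [Finset.filter_false_of_mem (s := twoParts (O \ ({o} ∪ ∅)) k) (fun _ _ => Finset.notMem_empty _), Finset.card_empty, zero_add, Finset.empty_union]
      split_ifs with hoq
      · subst hoq
        rw [Finset.filter_true_of_mem (fun _ _ => Finset.mem_singleton_self _),
          card_twoParts_of_card_eq (k := k) (by rw [Finset.card_sdiff_of_subset (Finset.singleton_subset_iff.2 ho), hO, Finset.card_singleton]; omega)]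
      · rw [Finset.filter_false_of_mem (fun _ _ h => hoq (Finset.mem_singleton.1 h).symm), Finset.card_empty]
    rw [h00, zero_add, Finset.sum_congr rfl h1, Finset.sum_ite_eq' O q', if_pos hq']

/-- The THIRD-LAYER MIDDLE CONSTANT `K_j = C(2j−7,3)(2j−11)‼ + 3(2j−7)(2j−9)‼`: the partitions of the `2j − 5` outside positions with two prescribed outer positions in
one block (`0, 3, 10, 63, 540` for `j = 3…7`). [cite: MadrasSlade1993, Definition 1.2.4; lane tool notion] -/
def thirdMidK (j : ℕ) : ℕ := (2 * j - 7).choose 3 * (2 * j - 11).doubleFactorial + 3 * (2 * j - 7) * (2 * j - 9).doubleFactorial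

open Classical in
/-- ★★ Two outer positions in one block: `#{d ∈ abData (2j−1) j p | q, q' ∈ A or q, q' ∈ B or a block of ρ ∋ q, q'} = K_j` (`j ≥ 4`): with `A = B = ∅` the pair block
(`C(2k−1,3)(2k−5)‼`) or the triple (`(2k−1)(2k−3)‼`); with one singleton `o ∉ {q, q'}` the pair block of a perfect matching (`2(2k−1)·(2k−3)‼`).
[cite: MadrasSlade1993, Definition 1.2.4; lane theorem] -/
theorem card_abData_filter_sameBlock (hj : 4 ≤ j) (hp : p + 4 ≤ 2 * j - 1) {q q' : Fin (2 * j - 1)} (hq : q ∈ outerPos (2 * j - 1) p hp)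
    (hq' : q' ∈ outerPos (2 * j - 1) p hp) (hne : q ≠ q') :
    ((abData (2 * j - 1) j p hp).filter fun d => (q ∈ d.1.1 ∧ q' ∈ d.1.1) ∨ (q ∈ d.1.2 ∧ q' ∈ d.1.2) ∨ ∃ B ∈ d.2, q ∈ B ∧ q' ∈ B).card = thirdMidK j := by
  obtain ⟨k, rfl⟩ : ∃ k, j = k + 4 := ⟨j - 4, by omega⟩
  have hO : (outerPos (2 * (k + 4) - 1) p hp).card = 2 * (k + 1) + 1 := by rw [card_outerPos hp]; omega
  unfold abData thirdMidK
  rw [filter_sigma_eq, Finset.card_sigma, show 2 * (k + 4) - 1 - (k + 4) - 2 = k + 1 by omega]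
  generalize hOdef : outerPos (2 * (k + 4) - 1) p hp = O at hO hq hq'
  refine (sum_disjPairs_eq O (fun AB => ((twoParts (O \ (AB.1 ∪ AB.2)) (k + 1)).filter fun ρ =>
    (q ∈ AB.1 ∧ q' ∈ AB.1) ∨ (q ∈ AB.2 ∧ q' ∈ AB.2) ∨ ∃ B ∈ ρ, q ∈ B ∧ q' ∈ B).card) (fun AB hAB hs => ?_)).trans ?_
  · rw [Finset.mem_filter, Finset.mem_product, Finset.mem_powerset, Finset.mem_powerset] at hAB
    obtain ⟨⟨hA, hB⟩, hd⟩ := hAB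
    have hle := Finset.card_le_card (Finset.union_subset hA hB)
    rw [Finset.card_union_of_disjoint hd, hO] at hle
    rw [twoParts_eq_empty_of_lt (by
      rw [Finset.card_sdiff_of_subset (Finset.union_subset hA hB), Finset.card_union_of_disjoint hd, hO]; omega), Finset.filter_empty,
      Finset.card_empty]
  -- `A = B = ∅`: the pair block or the triple
  have hpq : ({q, q'} : Finset (Fin (2 * (k + 4) - 1))) ⊆ O := by
    intro x hx; simp only [Finset.mem_insert, Finset.mem_singleton] at hx; rcases hx with rfl | rfl <;> assumption
  have h00 : ((twoParts (O \ ((∅ : Finset _) ∪ ∅)) (k + 1)).filter fun ρ => (q ∈ (∅ : Finset (Fin (2 * (k + 4) - 1))) ∧ q' ∈ (∅ : Finset (Fin (2 * (k + 4) - 1)))) ∨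
      (q ∈ (∅ : Finset (Fin (2 * (k + 4) - 1))) ∧ q' ∈ (∅ : Finset (Fin (2 * (k + 4) - 1)))) ∨ ∃ B ∈ ρ, q ∈ B ∧ q' ∈ B).card =
      (2 * k + 1).choose 3 * (2 * k - 3).doubleFactorial + (2 * k + 1) * (2 * k - 1).doubleFactorial := by
    rw [Finset.empty_union, Finset.sdiff_empty]
    have hsplit : ((twoParts O (k + 1)).filter fun ρ => (q ∈ (∅ : Finset (Fin (2 * (k + 4) - 1))) ∧ q' ∈ (∅ : Finset (Fin (2 * (k + 4) - 1)))) ∨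
        (q ∈ (∅ : Finset (Fin (2 * (k + 4) - 1))) ∧ q' ∈ (∅ : Finset (Fin (2 * (k + 4) - 1)))) ∨ ∃ B ∈ ρ, q ∈ B ∧ q' ∈ B) =
        ((twoParts O (k + 1)).filter fun ρ => ({q, q'} : Finset _) ∈ ρ) ∪ ((twoParts O (k + 1)).filter fun ρ => ∃ B ∈ ρ, q ∈ B ∧ q' ∈ B ∧ B.card = 3) := by
      rw [← Finset.filter_or]
      refine Finset.filter_congr fun ρ hρ => ?_
      rw [← sameBlock_iff_of_card_eq_succ hO hρ hne]
      simp only [Finset.notMem_empty, false_and, false_or]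
    have hdisj : Disjoint ((twoParts O (k + 1)).filter fun ρ => ({q, q'} : Finset _) ∈ ρ)
        ((twoParts O (k + 1)).filter fun ρ => ∃ B ∈ ρ, q ∈ B ∧ q' ∈ B ∧ B.card = 3) := by
      rw [Finset.disjoint_filter]
      rintro ρ hρ hpair ⟨B, hB, hqB, -, hB3⟩
      have := (mem_twoParts.1 hρ).1.eq_of_mem hpair hB (by simp : q ∈ ({q, q'} : Finset _)) hqB
      rw [← this, Finset.card_pair hne] at hB3
      omega
    rw [hsplit, Finset.card_union_of_disjoint hdisj, card_twoParts_filter_pair_mem hq hq' hne, card_twoParts_filter_triple_mem hO hq hq' hne,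
      card_twoParts_of_card_eq_succ (k := k) (by rw [Finset.card_sdiff_of_subset hpq, hO, Finset.card_pair hne]; omega)]
    have e1 : 2 * (k + 1) - 1 = 2 * k + 1 := by omega
    have e2 : 2 * (k + 1) - 3 = 2 * k - 1 := by omega
    rw [e1, e2]
  -- one singleton `o`: a perfect matching of `O ∖ {o}` with the pair block, `o ∉ {q, q'}`
  have hone : ∀ (o : Fin (2 * (k + 4) - 1)) (S : Finset (Fin (2 * (k + 4) - 1))), o ∈ O → S.card ≤ 1 →
      ((twoParts (O \ {o}) (k + 1)).filter fun ρ => (q ∈ S ∧ q' ∈ S) ∨ ∃ B ∈ ρ, q ∈ B ∧ q' ∈ B).card =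
        if o = q ∨ o = q' then 0 else (2 * k - 1).doubleFactorial := by
    intro o S ho hS
    have hOo : (O \ {o}).card = 2 * (k + 1) := by rw [Finset.card_sdiff_of_subset (Finset.singleton_subset_iff.2 ho), hO, Finset.card_singleton]; omega
    have hnotS : ¬ (q ∈ S ∧ q' ∈ S) := by
      rintro ⟨h1, h2⟩
      have := Finset.card_le_card (show ({q, q'} : Finset _) ⊆ S by
        intro x hx; simp only [Finset.mem_insert, Finset.mem_singleton] at hx; rcases hx with rfl | rfl <;> assumption)
      rw [Finset.card_pair hne] at this
      omega
    rw [Finset.filter_congr (fun ρ _ => or_iff_right hnotS)]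
    split_ifs with hoq
    · rw [Finset.card_eq_zero, Finset.filter_eq_empty_iff]
      rintro ρ hρ ⟨B, hB, hqB, hq'B⟩
      have hsub := (mem_twoParts.1 hρ).1.subset hB
      rcases hoq with rfl | rfl
      · have := hsub hqB; rw [Finset.mem_sdiff] at this; exact this.2 (Finset.mem_singleton_self _)
      · have := hsub hq'B; rw [Finset.mem_sdiff] at this; exact this.2 (Finset.mem_singleton_self _)
    · push Not at hoq
      have hqo : q ∈ O \ {o} := Finset.mem_sdiff.2 ⟨hq, by rw [Finset.mem_singleton]; exact Ne.symm hoq.1⟩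
      have hq'o : q' ∈ O \ {o} := Finset.mem_sdiff.2 ⟨hq', by rw [Finset.mem_singleton]; exact Ne.symm hoq.2⟩
      rw [Finset.filter_congr (fun ρ hρ => sameBlock_iff_of_card_eq hOo hρ hne), card_twoParts_filter_pair_mem hqo hq'o hne,
        card_twoParts_of_card_eq (k := k) (by
          rw [Finset.card_sdiff_of_subset (by
            intro x hx; simp only [Finset.mem_insert, Finset.mem_singleton] at hx; rcases hx with rfl | rfl <;> assumption), hOo, Finset.card_pair hne]
          omega)]
  have h1 : ∀ o ∈ O, ((twoParts (O \ ({o} ∪ ∅)) (k + 1)).filter fun ρ => (q ∈ ({o} : Finset (Fin (2 * (k + 4) - 1))) ∧ q' ∈ ({o} : Finset (Fin (2 * (k + 4) - 1)))) ∨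
      (q ∈ (∅ : Finset (Fin (2 * (k + 4) - 1))) ∧ q' ∈ (∅ : Finset (Fin (2 * (k + 4) - 1)))) ∨ ∃ B ∈ ρ, q ∈ B ∧ q' ∈ B).card +
      ((twoParts (O \ (∅ ∪ {o})) (k + 1)).filter fun ρ => (q ∈ (∅ : Finset (Fin (2 * (k + 4) - 1))) ∧ q' ∈ (∅ : Finset (Fin (2 * (k + 4) - 1)))) ∨
      (q ∈ ({o} : Finset (Fin (2 * (k + 4) - 1))) ∧ q' ∈ ({o} : Finset (Fin (2 * (k + 4) - 1)))) ∨ ∃ B ∈ ρ, q ∈ B ∧ q' ∈ B).card =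
      if o = q ∨ o = q' then 0 else 2 * (2 * k - 1).doubleFactorial := by
    intro o ho
    rw [Finset.union_empty, Finset.empty_union]
    have ha := hone o {o} ho (by rw [Finset.card_singleton])
    have e1 : ((twoParts (O \ {o}) (k + 1)).filter fun ρ => (q ∈ ({o} : Finset (Fin (2 * (k + 4) - 1))) ∧ q' ∈ ({o} : Finset (Fin (2 * (k + 4) - 1)))) ∨
        (q ∈ (∅ : Finset (Fin (2 * (k + 4) - 1))) ∧ q' ∈ (∅ : Finset (Fin (2 * (k + 4) - 1)))) ∨ ∃ B ∈ ρ, q ∈ B ∧ q' ∈ B) =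
        ((twoParts (O \ {o}) (k + 1)).filter fun ρ => (q ∈ ({o} : Finset _) ∧ q' ∈ ({o} : Finset _)) ∨ ∃ B ∈ ρ, q ∈ B ∧ q' ∈ B) := by
      refine Finset.filter_congr fun ρ _ => ?_; simp only [Finset.notMem_empty, false_and, false_or]
    have e2 : ((twoParts (O \ {o}) (k + 1)).filter fun ρ => (q ∈ (∅ : Finset (Fin (2 * (k + 4) - 1))) ∧ q' ∈ (∅ : Finset (Fin (2 * (k + 4) - 1)))) ∨
        (q ∈ ({o} : Finset (Fin (2 * (k + 4) - 1))) ∧ q' ∈ ({o} : Finset (Fin (2 * (k + 4) - 1)))) ∨ ∃ B ∈ ρ, q ∈ B ∧ q' ∈ B) =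
        ((twoParts (O \ {o}) (k + 1)).filter fun ρ => (q ∈ ({o} : Finset _) ∧ q' ∈ ({o} : Finset _)) ∨ ∃ B ∈ ρ, q ∈ B ∧ q' ∈ B) := by
      refine Finset.filter_congr fun ρ _ => ?_; simp only [Finset.notMem_empty, false_and, false_or]
    rw [e1, e2, ha]
    split_ifs <;> ring
  rw [h00, Finset.sum_congr rfl h1, ← Finset.sum_filter_add_sum_filter_not O (fun o => o = q ∨ o = q'),
    Finset.sum_eq_zero (fun o ho => by rw [if_pos (Finset.mem_filter.1 ho).2]), zero_add,
    Finset.sum_congr rfl (fun o ho => by rw [if_neg (Finset.mem_filter.1 ho).2]), Finset.sum_const, smul_eq_mul]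
  have hc : (O.filter fun o => ¬ (o = q ∨ o = q')).card = 2 * k + 1 := by
    have : (O.filter fun o => (o = q ∨ o = q')) = {q, q'} := by
      ext x; simp only [Finset.mem_filter, Finset.mem_insert, Finset.mem_singleton]
      constructor
      · exact fun h => h.2
      · intro h; refine ⟨?_, h⟩; rcases h with rfl | rfl <;> assumption
    have h2 := Finset.card_filter_add_card_filter_not (s := O) (fun o => o = q ∨ o = q')
    rw [this, Finset.card_pair hne, hO] at h2
    omega
  rw [hc]
  have e1 : 2 * (k + 4) - 7 = 2 * k + 1 := by omega
  have e2 : 2 * (k + 4) - 11 = 2 * k - 3 := by omega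
  have e3 : 2 * (k + 4) - 9 = 2 * k - 1 := by omega
  rw [e1, e2, e3]
  ring

end AB

/-! ### ★★ Prescribed letters on `2j − 1` letters -/

section Mid

variable {j p : ℕ}

/-- Outer positions are free and differ from `p`, `p+1`. [cite: MadrasSlade1993, Definition 1.2.4; lane plumbing] -/
private theorem outer_facts_mid (hp : p + 4 ≤ m) {q' : Fin m} (hq' : q' ∈ outerPos m p hp) :
    q' ∈ freePos m p ∧ (⟨p, by omega⟩ : Fin m) ≠ q' ∧ (⟨p + 1, by omega⟩ : Fin m) ≠ q' := by
  obtain ⟨hF, h0, h1⟩ := (mem_outerPos hp).1 hq'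
  exact ⟨hF, fun h => h0 (by rw [← h]), fun h => h1 (by rw [← h])⟩

/-- ★★ An outer letter EQUAL to the letter at `p`: `#{κ ∈ T_p | κ q' = κ p} = (2j−7)‼·2^{2j−4}` on `2j − 1` letters (`j ≥ 3`).
[cite: MadrasSlade1993, Definition 1.2.4; lane theorem] -/
theorem card_filter_letter_base_mid (hj : 3 ≤ j) (hp : p + 4 ≤ 2 * j - 1) {q' : Fin (2 * j - 1)} (hq' : q' ∈ outerPos (2 * j - 1) p hp) :
    ((shapeClass j (2 * j - 1) (topVec (2 * j - 1) p)).filter fun κ => κ q' = κ ⟨p, by omega⟩).card = (2 * j - 7).doubleFactorial * 2 ^ (2 * j - 4) := by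
  classical
  obtain ⟨hF, h0, -⟩ := outer_facts_mid hp hq'
  rw [card_filter_letter_eq hp (p_mem_freePos hp).1 hF h0, card_goodParts_filter_blockOf_base hp (by omega) hq', card_abData_filter_fst hj hp hq',
    show 2 * j - 1 - 3 = 2 * j - 4 by omega]

/-- ★★ An outer letter REVERSED to the letter at `p`: `#{κ ∈ T_p | κ q' = rev κ p} = (2j−7)‼·2^{2j−4}` on `2j − 1` letters (`j ≥ 3`).
[cite: MadrasSlade1993, Definition 1.2.4; lane theorem] -/
theorem card_filter_letter_base_rev_mid (hj : 3 ≤ j) (hp : p + 4 ≤ 2 * j - 1) {q' : Fin (2 * j - 1)} (hq' : q' ∈ outerPos (2 * j - 1) p hp) :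
    ((shapeClass j (2 * j - 1) (topVec (2 * j - 1) p)).filter fun κ =>
        κ q' = ((κ ⟨p, by omega⟩).1, !(κ ⟨p, by omega⟩).2)).card = (2 * j - 7).doubleFactorial * 2 ^ (2 * j - 4) := by
  classical
  obtain ⟨hF, h0, -⟩ := outer_facts_mid hp hq'
  rw [card_filter_letter_rev hp (p_mem_freePos hp).1 hF h0, card_goodParts_filter_blockOf_base hp (by omega) hq', card_abData_filter_fst hj hp hq',
    show 2 * j - 1 - 3 = 2 * j - 4 by omega]

/-- ★★ An outer letter EQUAL to the letter at `p+1`: `#{κ ∈ T_p | κ q' = κ (p+1)} = (2j−7)‼·2^{2j−4}` on `2j − 1` letters (`j ≥ 3`).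
[cite: MadrasSlade1993, Definition 1.2.4; lane theorem] -/
theorem card_filter_letter_succ_mid (hj : 3 ≤ j) (hp : p + 4 ≤ 2 * j - 1) {q' : Fin (2 * j - 1)} (hq' : q' ∈ outerPos (2 * j - 1) p hp) :
    ((shapeClass j (2 * j - 1) (topVec (2 * j - 1) p)).filter fun κ => κ q' = κ ⟨p + 1, by omega⟩).card = (2 * j - 7).doubleFactorial * 2 ^ (2 * j - 4) := by
  classical
  obtain ⟨hF, -, h1⟩ := outer_facts_mid hp hq'
  rw [card_filter_letter_eq hp (p_mem_freePos hp).2 hF h1, card_goodParts_filter_blockOf_succ hp (by omega) hq', card_abData_filter_snd hj hp hq',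
    show 2 * j - 1 - 3 = 2 * j - 4 by omega]

/-- ★★ A REVERSAL PAIR at two outer positions: `#{κ ∈ T_p | κ q' = rev κ q} = K_j·2^{2j−4}` on `2j − 1` letters (`j ≥ 4`).
[cite: MadrasSlade1993, Definition 1.2.4; lane theorem] -/
theorem card_filter_rev_outer_mid (hj : 4 ≤ j) (hp : p + 4 ≤ 2 * j - 1) {q q' : Fin (2 * j - 1)} (hq : q ∈ outerPos (2 * j - 1) p hp)
    (hq' : q' ∈ outerPos (2 * j - 1) p hp) (hne : q ≠ q') :
    ((shapeClass j (2 * j - 1) (topVec (2 * j - 1) p)).filter fun κ => κ q' = ((κ q).1, !(κ q).2)).card = thirdMidK j * 2 ^ (2 * j - 4) := by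
  classical
  rw [card_filter_letter_rev hp ((mem_outerPos hp).1 hq).1 ((mem_outerPos hp).1 hq').1 hne, card_goodParts_filter_blockOf_outer hp (by omega) hq hq',
    card_abData_filter_sameBlock hj hp hq hq' hne, show 2 * j - 1 - 3 = 2 * j - 4 by omega]

/-! ### ★★ The five-run and split classes on `2j − 1` letters -/

/-- ★★ THE FIVE-RUN CLASS ON `2j − 1` LETTERS: `3·#shapeClass j (2j−1) (fiveVec (2j−1) s) + 9·(2j−7)‼·2^{2j−4} = 2(j+3)(2j−5)‼·2^{2j−3}` (`j ≥ 3`, `s + 5 ≤ 2j − 1`):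
two one-block classes (`(j+3)(2j−5)‼2^{2j−3}/3` each) minus the three exceptional families `x y x̄ ȳ y`, `x̄ x y x̄ ȳ`, `x y x̄ ȳ x` (`(2j−7)‼2^{2j−4}` each).
[cite: MadrasSlade1993, Definition 1.2.4; lane theorem] -/
theorem three_mul_card_shapeClass_fiveVec_mid {s : ℕ} (hj : 3 ≤ j) (hs : s + 5 ≤ 2 * j - 1) :
    3 * (shapeClass j (2 * j - 1) (fiveVec (2 * j - 1) s)).card + 9 * ((2 * j - 7).doubleFactorial * 2 ^ (2 * j - 4)) =
      2 * ((j + 3) * ((2 * j - 5).doubleFactorial * 2 ^ (2 * j - 3))) := by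
  classical
  have hadd := card_shapeClass_fiveVec_add (j := j) hs
  have hs4 : (⟨s + 4, by omega⟩ : Fin (2 * j - 1)) ∈ outerPos (2 * j - 1) s (by omega) := by
    rw [mem_outerPos]; unfold freePos; simp only [Finset.mem_filter, Finset.mem_univ, true_and]; omega
  have hs0 : (⟨s, by omega⟩ : Fin (2 * j - 1)) ∈ outerPos (2 * j - 1) (s + 1) hs := by
    rw [mem_outerPos]; unfold freePos; simp only [Finset.mem_filter, Finset.mem_univ, true_and]; omega
  rw [card_filter_letter_succ_mid hj (by omega) hs4, card_filter_letter_base_mid hj (by omega) hs4, card_filter_letter_base_rev_mid hj hs hs0] at hadd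
  have h0 := three_mul_card_shapeClass_secondLower (p := s) hj (by omega)
  have h1 := three_mul_card_shapeClass_secondLower (p := s + 1) hj hs
  omega

/-- ★★ THE SPLIT CLASS ON `2j − 1` LETTERS: `3·#shapeClass j (2j−1) (splitVec (2j−1) i q) + 3·K_j·2^{2j−4} = (j+3)(2j−5)‼·2^{2j−3}` (`j ≥ 4`, `i + 4 ≤ 2j − 1`,
`q` separated):
the one-block class minus the reversal pairs at `(q, q+1)`. [cite: MadrasSlade1993, Definition 1.2.4; lane theorem] -/
theorem three_mul_card_shapeClass_splitVec_mid {i q : ℕ} (hj : 4 ≤ j) (hi : i + 4 ≤ 2 * j - 1) (hq : SepAdj (2 * j - 1) i q) :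
    3 * (shapeClass j (2 * j - 1) (splitVec (2 * j - 1) i q)).card + 3 * (thirdMidK j * 2 ^ (2 * j - 4)) = (j + 3) * ((2 * j - 5).doubleFactorial * 2 ^ (2 * j - 3)) := by
  classical
  have hq' := hq; unfold SepAdj at hq'
  have h := Finset.card_filter_add_card_filter_not (s := shapeClass j (2 * j - 1) (topVec (2 * j - 1) i))
    (fun κ => κ ⟨q + 1, by omega⟩ = ((κ ⟨q, by omega⟩).1, !(κ ⟨q, by omega⟩).2))
  have hQ : (⟨q, by omega⟩ : Fin (2 * j - 1)) ∈ outerPos (2 * j - 1) i hi := by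
    rw [mem_outerPos]; unfold freePos; simp only [Finset.mem_filter, Finset.mem_univ, true_and]; omega
  have hQ1 : (⟨q + 1, by omega⟩ : Fin (2 * j - 1)) ∈ outerPos (2 * j - 1) i hi := by
    rw [mem_outerPos]; unfold freePos; simp only [Finset.mem_filter, Finset.mem_univ, true_and]; omega
  rw [card_filter_rev_outer_mid hj hi hQ hQ1 (by simp [Fin.ext_iff]), ← shapeClass_splitVec_eq_filter hi hq] at h
  have h0 := three_mul_card_shapeClass_secondLower (p := i) (by omega) hi
  omega

/-! ### ★★★ The third-layer middle census -/

open Classical in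
/-- ★★★ THE THIRD-LAYER MIDDLE CENSUS FOR EVERY `j ≥ 3`: `3·X'_j + (2j−5)·(9(2j−7)‼ + 3(2j−6)K_j)·2^{2j−4} = (2j−5)(2j−4)(j+3)(2j−5)‼·2^{2j−3}`,
`X'_j = thirdShapeSumMid j`,
`K_j = thirdMidK j` — the classes with `2j − 5` breaks on `2j − 1` letters are the `2j − 5` five-run classes and the `(2j−5)(2j−6)` split classes (6c's classification), each counted
above (`X'_3 … X'_8 = 20, 2256, 137920, 8359680, 546739200, 39242649600`; BR-3 = `X'_8`). [cite: MadrasSlade1993, §1.1 eq. (1.1.8) p. 5; Definition 1.2.4]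
[cite: ClisbyLiangSlade2007, §3.3 eqs. (29)/(31); lane theorem] -/
theorem three_mul_thirdShapeSumMid_add (j : ℕ) (hj : 3 ≤ j) :
    3 * thirdShapeSumMid j + (2 * j - 5) * ((9 * (2 * j - 7).doubleFactorial + 3 * (2 * j - 6) * thirdMidK j) * 2 ^ (2 * j - 4)) =
      (2 * j - 5) * (2 * j - 4) * ((j + 3) * ((2 * j - 5).doubleFactorial * 2 ^ (2 * j - 3))) := by
  unfold thirdShapeSumMid
  set m := 2 * j - 1 with hm
  set f : (Fin m → Bool) → ℕ := fun A => if AdjValid A ∧ breaks A = 2 * j - 5 then (shapeClass j m A).card else 0 with hf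
  set I5 := (Finset.range (m - 4)).image (fiveVec m) with hI5
  set I42 := ((Finset.range (m - 4)).offDiag).image (fun ab => splitVec m (splitIdx ab).1 (splitIdx ab).2) with hI42
  have hm4 : m - 4 = 2 * j - 5 := by omega
  -- every other vector contributes nothing
  have hvan : ∀ A ∈ (Finset.univ : Finset (Fin m → Bool)), A ∉ I5 ∪ I42 → f A = 0 := by
    intro A _ hA
    rw [hf]; simp only
    split_ifs with h
    · by_contra hne
      obtain ⟨κ, hκ⟩ := Finset.card_pos.1 (Nat.pos_of_ne_zero hne)
      rcases exists_eq_fiveVec_or_splitVec (by rw [h.2]; omega) h.1 hκ with ⟨s, hs, rfl⟩ | ⟨ab, hab, rfl⟩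
      · exact hA (Finset.mem_union_left _ (Finset.mem_image.2 ⟨s, Finset.mem_range.2 (by omega), rfl⟩))
      · exact hA (Finset.mem_union_right _ (Finset.mem_image.2 ⟨ab, hab, rfl⟩))
    · rfl
  have hdisj : Disjoint I5 I42 := by
    rw [Finset.disjoint_left]
    intro A h5 h42
    obtain ⟨s, hs, rfl⟩ := Finset.mem_image.1 h5
    obtain ⟨ab, hab, heq⟩ := Finset.mem_image.1 h42
    obtain ⟨hi, hsep⟩ := splitIdx_sepAdj hab
    exact fiveVec_ne_splitVec hi hsep heq.symm
  have hinj5 : Set.InjOn (fiveVec m) ↑(Finset.range (m - 4)) := by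
    intro s hs s' hs' h
    rw [Finset.mem_coe, Finset.mem_range] at hs hs'
    exact fiveVec_inj (by omega) (by omega) h
  have hinj42 : Set.InjOn (fun ab => splitVec m (splitIdx ab).1 (splitIdx ab).2) ↑((Finset.range (m - 4)).offDiag) := by
    intro ab hab ab' hab' h
    rw [Finset.mem_coe] at hab hab'
    obtain ⟨hi, hsep⟩ := splitIdx_sepAdj hab
    obtain ⟨hi', hsep'⟩ := splitIdx_sepAdj hab'
    obtain ⟨h1, h2⟩ := splitVec_inj hi hsep hi' hsep' h
    exact splitIdx_inj hab hab' (Prod.ext h1 h2)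
  -- the values on the two families
  have hval5 : ∀ s ∈ Finset.range (m - 4), 3 * f (fiveVec m s) + 9 * ((2 * j - 7).doubleFactorial * 2 ^ (2 * j - 4)) =
      2 * ((j + 3) * ((2 * j - 5).doubleFactorial * 2 ^ (2 * j - 3))) := by
    intro s hs
    rw [Finset.mem_range] at hs
    rw [hf]; simp only
    rw [if_pos ⟨adjValid_fiveVec (by omega), (breaks_fiveVec (by omega)).trans (by omega)⟩]
    exact three_mul_card_shapeClass_fiveVec_mid hj (by omega)
  have hval42 : ∀ ab ∈ (Finset.range (m - 4)).offDiag,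
      3 * f (splitVec m (splitIdx ab).1 (splitIdx ab).2) + 3 * (thirdMidK j * 2 ^ (2 * j - 4)) = (j + 3) * ((2 * j - 5).doubleFactorial * 2 ^ (2 * j - 3)) := by
    intro ab hab
    obtain ⟨hi, hsep⟩ := splitIdx_sepAdj hab
    have hj4 : 4 ≤ j := by
      rw [Finset.mem_offDiag, Finset.mem_range, Finset.mem_range] at hab; omega
    rw [hf]; simp only
    rw [if_pos ⟨adjValid_splitVec hi hsep, (breaks_splitVec hi hsep).trans (by omega)⟩]
    exact three_mul_card_shapeClass_splitVec_mid hj4 hi hsep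
  -- assemble
  have hcard : ((Finset.range (m - 4)).offDiag).card = (2 * j - 5) * (2 * j - 6) := by
    rw [Finset.offDiag_card, Finset.card_range, hm4]
    rcases Nat.lt_or_ge j 4 with h | h
    · have h1 : 2 * j - 5 = 1 := by omega
      have h2 : 2 * j - 6 = 0 := by omega
      rw [h1, h2]
    · have h5 : 2 * j - 5 = (2 * j - 6) + 1 := by omega
      rw [h5]; exact Nat.sub_eq_of_eq_add (by ring)
  have step1 : ∑ A, f A = ∑ s ∈ Finset.range (m - 4), f (fiveVec m s) +
      ∑ ab ∈ (Finset.range (m - 4)).offDiag, f (splitVec m (splitIdx ab).1 (splitIdx ab).2) := by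
    rw [← Finset.sum_subset (Finset.subset_univ _) hvan, Finset.sum_union hdisj, Finset.sum_image hinj5, Finset.sum_image hinj42]
  rw [show (∑ A, f A) = Finset.univ.sum f from rfl] at step1
  show 3 * Finset.univ.sum f + _ = _
  rw [step1]
  set S5 := ∑ s ∈ Finset.range (m - 4), f (fiveVec m s) with hS5
  set S42 := ∑ ab ∈ (Finset.range (m - 4)).offDiag, f (splitVec m (splitIdx ab).1 (splitIdx ab).2) with hS42
  set P := 2 ^ (2 * j - 4) with hP
  set Y := (j + 3) * ((2 * j - 5).doubleFactorial * 2 ^ (2 * j - 3)) with hY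
  have step2 : 3 * S5 + (m - 4) * (9 * ((2 * j - 7).doubleFactorial * P)) = (m - 4) * (2 * Y) := by
    rw [hS5, Finset.mul_sum, show (m - 4) * (9 * ((2 * j - 7).doubleFactorial * P)) =
      ∑ s ∈ Finset.range (m - 4), 9 * ((2 * j - 7).doubleFactorial * P) by rw [Finset.sum_const, Finset.card_range, smul_eq_mul],
      ← Finset.sum_add_distrib, Finset.sum_congr rfl (fun s hs => hval5 s hs), Finset.sum_const, Finset.card_range, smul_eq_mul]
  have step3 : 3 * S42 + ((Finset.range (m - 4)).offDiag).card * (3 * (thirdMidK j * P)) = ((Finset.range (m - 4)).offDiag).card * Y := by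
    rw [hS42, Finset.mul_sum, show ((Finset.range (m - 4)).offDiag).card * (3 * (thirdMidK j * P)) =
      ∑ ab ∈ (Finset.range (m - 4)).offDiag, 3 * (thirdMidK j * P) by rw [Finset.sum_const, smul_eq_mul],
      ← Finset.sum_add_distrib, Finset.sum_congr rfl (fun ab hab => hval42 ab hab), Finset.sum_const, smul_eq_mul]
  rw [hm4] at step2
  rw [hcard] at step3
  have e24 : 2 * j - 4 = (2 * j - 6) + 2 := by omega
  rw [e24]
  calc 3 * (S5 + S42) + (2 * j - 5) * ((9 * (2 * j - 7).doubleFactorial + 3 * (2 * j - 6) * thirdMidK j) * P)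
      = (3 * S5 + (2 * j - 5) * (9 * ((2 * j - 7).doubleFactorial * P))) + (3 * S42 + (2 * j - 5) * (2 * j - 6) * (3 * (thirdMidK j * P))) := by ring
    _ = (2 * j - 5) * (2 * Y) + (2 * j - 5) * (2 * j - 6) * Y := by rw [step2, step3]
    _ = (2 * j - 5) * (2 * j - 6 + 2) * Y := by ring

/-- The instances `j = 3, …, 8`: `X'_3 = 20`, `X'_4 = 2256`, `X'_5 = 137920`, `X'_6 = 8359680`, `X'_7 = 546 739 200`, `X'_8 = 39 242 649 600` (BR-3).
[cite: MadrasSlade1993, Definition 1.2.4; lane theorem] -/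
theorem thirdShapeSumMid_values :
    thirdShapeSumMid 3 = 20 ∧ thirdShapeSumMid 4 = 2256 ∧ thirdShapeSumMid 5 = 137920 ∧ thirdShapeSumMid 6 = 8359680 ∧ thirdShapeSumMid 7 = 546739200 ∧
      thirdShapeSumMid 8 = 39242649600 := by
  have h3 := three_mul_thirdShapeSumMid_add 3 le_rfl
  have h4 := three_mul_thirdShapeSumMid_add 4 (by norm_num)
  have h5 := three_mul_thirdShapeSumMid_add 5 (by norm_num)
  have h6 := three_mul_thirdShapeSumMid_add 6 (by norm_num)
  have h7 := three_mul_thirdShapeSumMid_add 7 (by norm_num)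
  have h8 := three_mul_thirdShapeSumMid_add 8 (by norm_num)
  simp only [thirdMidK] at h3 h4 h5 h6 h7 h8
  norm_num [Nat.choose, Nat.doubleFactorial] at h3 h4 h5 h6 h7 h8
  omega

end Mid

end WordTypes

end Literature.Probability.RandomPlanarGeometry.SAW.Zd
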